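import Mathlib
import Summits.Ventures.DiscreteObjects.Mahler.ConfluentVandermonde
import Summits.Ventures.DiscreteObjects.Mahler.DobrowolskiSeparation
import Summits.Ventures.DiscreteObjects.Mahler.DobrowolskiLemma
import Summits.Ventures.DiscreteObjects.Mahler.DobrowolskiWeakBound

/-!
# Dobrowolski's determinant inequality (Cantor–Straus) (venture `DiscreteObjects`, target L)

Cell `pub-namedobj`, seat `pub-namedobj-mahler-g27`. Framing: lottery ticket; floor = certified bounds/negative ranges.

[cite: MckeeSmyth2021, §3.2, proof of Theorem 3.1 up to (3.10)] (Cantor–Straus 1982): let `f ∈ ℤ[X]` be monic,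
irreducible, with `M(f) > 1` and NONDEGENERATE (no two distinct roots have a common positive power), with complex roots
`α_1, …, α_d`; let `S ≥ 0` and let `q_1, …, q_T` be distinct primes.  The confluent Vandermonde determinant `V` on the
nodes `α_i` (multiplicity `S`) and `α_i^{q_j}` (multiplicity `1`) — `N = d(S+T)` columns — satisfies
`(∏_j q_j)^{2dS} ≤ |V|² ≤ N^{d(S²+T)} · M(f)^{2(N-1)(S + Σ_j q_j)}`, whence
**`(∏_j q_j)^{2dS} ≤ N^{d(S²+T)} · M(f)^{2(N-1)(S + Σ_j q_j)}`** (`prime_prod_pow_le_of_nondegenerate`).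
The upper bound is Hadamard's inequality (`ConfluentVandermonde.norm_det_confluentVandermonde_sq_le`); the lower bound
splits `|V|² = ∏_{v_c ≠ v_{c'}} |v_c - v_{c'}|` (`norm_det_confluentVandermonde_sq`) into the discriminant part
`(∏_{i≠i'}|α_i-α_{i'}|)^{S²} ≥ 1`, the cross part `∏_{(i,j)≠(i',j')} |α_i^{q_j} - α_{i'}^{q_{j'}}| ≥ 1` (a nonzero integer,
`DobrowolskiSeparation`) and the resultant part `∏_j |Res(f, f(X^{q_j}))|^{2S} ≥ ∏_j q_j^{2dS}` (Dobrowolski's Lemma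
`p^d ∣ Res(f, f(X^p))`, `DobrowolskiLemma`).  The columns are indexed by `Fin d ×ₗ (Fin S ⊕ₗ Fin T)`; the distinctness
of the nodes is `DobrowolskiSeparation.root_pow_ne_root_pow`.  Brick no. 2 for Dobrowolski's theorem
[cite: MckeeSmyth2021, Theorem 3.1].  REPLICATION, no new mathematics.
-/

namespace Summit.Ventures.DiscreteObjects.Mahler

open Polynomial Finset

/-- `Σ_{s<S} (2s+1) = S²` (the exponent of `N` contributed by a node of multiplicity `S`). -/
theorem sum_fin_two_mul_add_one (S : ℕ) : ∑ s : Fin S, (2 * (s : ℕ) + 1) = S ^ 2 := by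
  induction S with
  | zero => simp
  | succ S ih => rw [Fin.sum_univ_castSucc]; simp [ih]; ring

/-- **Dobrowolski's determinant inequality** [cite: MckeeSmyth2021, §3.2 up to (3.10)] (Cantor–Straus).  Let
`f ∈ ℤ[X]` be monic, irreducible, nondegenerate, with `M(f) > 1` and degree `d`; let `S ≥ 0` and let
`q_1, …, q_T` be distinct primes.  Then, with `N = d(S+T)`,
`(∏_j q_j)^{2dS} ≤ N^{d(S²+T)} · M(f)^{2(N-1)(S + Σ_j q_j)}`. -/
theorem prime_prod_pow_le_of_nondegenerate (f : ℤ[X]) (hmon : f.Monic) (hirr : Irreducible f)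
    (hM : 1 < intMahlerMeasure f)
    (hnd : ∀ a ∈ (f.map (Int.castRingHom ℂ)).roots, ∀ b ∈ (f.map (Int.castRingHom ℂ)).roots, a ≠ b →
      ∀ n : ℕ, 0 < n → a ^ n ≠ b ^ n)
    (S : ℕ) {T : ℕ} (q : Fin T → ℕ) (hq : ∀ j, (q j).Prime) (hqinj : Function.Injective q) :
    ((∏ j, (q j : ℝ)) ^ f.natDegree) ^ (2 * S) ≤
      ((f.natDegree * (S + T) : ℕ) : ℝ) ^ (f.natDegree * (S ^ 2 + T)) *
        intMahlerMeasure f ^ (2 * (f.natDegree * (S + T) - 1) * (S + ∑ j, q j)) := by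
  classical
  -- (0) the roots as an injective family `α : Fin n → ℂ`
  set g := f.map (Int.castRingHom ℂ) with hg
  set R := g.roots with hR
  have hgmon : g.Monic := hmon.map _
  have hsplit : g.Splits := IsAlgClosed.splits g
  have hdeg : 0 < f.natDegree := natDegree_pos_of_one_lt_measure hmon hM
  have hcard : R.card = f.natDegree := by
    rw [hR, splits_iff_card_roots.1 hsplit, hg, natDegree_map_eq_of_injective (Int.castRingHom ℂ).injective_int]
  set L := R.toList with hL
  set n := L.length with hn
  have hnd' : n = f.natDegree := by rw [hn, hL, Multiset.length_toList, hcard]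
  set α : Fin n → ℂ := fun i => L.get i with hαdef
  have hα : (Finset.univ.val.map α : Multiset ℂ) = R := by
    rw [Fin.univ_val_map]
    have hof : List.ofFn α = L := List.ofFn_get L
    rw [hof]
    exact Multiset.coe_toList R
  have hαmem : ∀ i, α i ∈ R := fun i => by
    rw [← hα]
    exact Multiset.mem_map.2 ⟨i, Finset.mem_def.1 (Finset.mem_univ i), rfl⟩
  have hαinj : Function.Injective α := by
    have : (Finset.univ.val.map α).Nodup := by rw [hα]; exact nodup_roots_of_irreducible hirr hdeg
    exact (Multiset.nodup_map_iff_inj_on Finset.univ.nodup).1 this |> fun h a b hab =>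
      h a (Finset.mem_univ a) b (Finset.mem_univ b) hab
  have hnpos : 0 < n := by omega
  -- (1) the node configuration on `ι = Fin n ×ₗ (Fin S ⊕ₗ Fin T)`
  let ex : Fin S ⊕ Fin T → ℕ := Sum.elim (fun _ => 1) (fun j => q j)
  let cls : Fin S ⊕ Fin T → Option (Fin T) := Sum.elim (fun _ => none) (fun j => some j)
  let nd : Fin n × (Fin S ⊕ Fin T) → ℂ := fun y => α y.1 ^ ex y.2
  let E : Fin n × (Fin S ⊕ Fin T) ≃ (Fin n ×ₗ (Fin S ⊕ₗ Fin T)) :=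
    ((Equiv.refl (Fin n)).prodCongr toLex).trans toLex
  let v : (Fin n ×ₗ (Fin S ⊕ₗ Fin T)) → ℂ := fun c => nd (E.symm c)
  have hvE : ∀ y, v (E y) = nd y := fun y => by simp [v]
  have hex_pos : ∀ x, 0 < ex x := by
    rintro (s | j)
    · exact Nat.one_pos
    · exact (hq j).pos
  have hex_cls : ∀ x x', ex x' = ex x ↔ cls x' = cls x := by
    rintro (s | j) (s' | j')
    · simp [ex, cls]
    · simp [ex, cls, (hq j').ne_one]
    · simp [ex, cls, (hq j).ne_one.symm]
    · simp [ex, cls, hqinj.eq_iff]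
  have hnode : ∀ y y' : Fin n × (Fin S ⊕ Fin T), nd y' = nd y ↔ (y'.1 = y.1 ∧ cls y'.2 = cls y.2) := by
    intro y y'
    constructor
    · intro h
      have hexeq : ex y'.2 = ex y.2 := by
        by_contra hne
        exact root_pow_ne_root_pow hmon hirr hM hnd (hαmem y'.1) (hαmem y.1) (hex_pos _) (hex_pos _) hne h
      refine ⟨?_, (hex_cls _ _).1 hexeq⟩
      by_contra hne
      have h' : α y'.1 ^ ex y.2 = α y.1 ^ ex y.2 := by
        have h2 : α y'.1 ^ ex y'.2 = α y.1 ^ ex y.2 := h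
        rwa [hexeq] at h2
      exact hnd _ (hαmem y'.1) _ (hαmem y.1) (fun e => hne (hαinj e)) _ (hex_pos _) h'
    · rintro ⟨h1, h2⟩
      show α y'.1 ^ ex y'.2 = α y.1 ^ ex y.2
      rw [h1, (hex_cls _ _).2 h2]
  -- (2) the column orders
  have hco_inl : ∀ i s, colOrder v (E (i, Sum.inl s)) ≤ s := by
    intro i s
    unfold colOrder
    have hinj : Function.Injective (fun s' : Fin S => E (i, Sum.inl s')) := by
      intro a b h
      simpa using E.injective h
    calc (univ.filter (fun c' => c' < E (i, Sum.inl s) ∧ v c' = v (E (i, Sum.inl s)))).card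
        ≤ ((univ.filter (· < s)).map ⟨_, hinj⟩).card := by
          apply Finset.card_le_card
          intro c' hc'
          rw [Finset.mem_filter] at hc'
          obtain ⟨-, hlt, hveq⟩ := hc'
          obtain ⟨⟨i', x'⟩, rfl⟩ := E.surjective c'
          rw [hvE, hvE] at hveq
          obtain ⟨h1, h2⟩ := (hnode _ _).1 hveq
          simp only at h1
          subst h1
          rcases x' with s' | j'
          · change toLex ((_, toLex (Sum.inl s' : Fin S ⊕ Fin T)) : Fin n × (Fin S ⊕ₗ Fin T)) <
              toLex ((_, toLex (Sum.inl s : Fin S ⊕ Fin T)) : Fin n × (Fin S ⊕ₗ Fin T)) at hlt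
            rw [Prod.Lex.toLex_lt_toLex] at hlt
            simp only [lt_self_iff_false, true_and, false_or] at hlt
            have hs : s' < s := Sum.Lex.inl_lt_inl_iff.1 hlt
            rw [Finset.mem_map]
            exact ⟨s', by simp [hs], rfl⟩
          · simp [cls] at h2
      _ = s := by
          rw [Finset.card_map]
          have : univ.filter (· < s) = Finset.Iio s := by ext; simp
          rw [this]
          exact Fin.card_Iio s
  have hco_inr : ∀ i j, colOrder v (E (i, Sum.inr j)) = 0 := by
    intro i j
    unfold colOrder
    rw [Finset.card_eq_zero, Finset.filter_eq_empty_iff]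
    rintro c' - ⟨hlt, hveq⟩
    obtain ⟨⟨i', x'⟩, rfl⟩ := E.surjective c'
    rw [hvE, hvE] at hveq
    obtain ⟨h1, h2⟩ := (hnode _ _).1 hveq
    simp only at h1
    subst h1
    rcases x' with s' | j'
    · simp [cls] at h2
    · simp only [cls, Sum.elim_inr, Option.some.injEq] at h2
      subst h2
      exact lt_irrefl _ hlt
  -- (3) the Mahler measure and the size `N`
  set N := n * (S + T) with hN
  have hcardι : Fintype.card (Fin n ×ₗ (Fin S ⊕ₗ Fin T)) = N := by simp [hN]
  have hMeq : intMahlerMeasure f = ∏ i : Fin n, max 1 ‖α i‖ := by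
    unfold intMahlerMeasure
    rw [mahlerMeasure_eq_leadingCoeff_mul_prod_roots, ← hg, hgmon.leadingCoeff, norm_one, one_mul, ← hR]
    exact multiset_prod_map_eq_prod α hα _
  -- (4) the upper bound (Hadamard)
  have hup : ‖(confluentVandermonde v (colOrder v)).det‖ ^ 2 ≤
      (N : ℝ) ^ (n * (S ^ 2 + T)) * intMahlerMeasure f ^ (2 * (N - 1) * (S + ∑ j, q j)) := by
    refine (norm_det_confluentVandermonde_sq_le v (colOrder v)).trans ?_
    rw [hcardι]
    let bnd : Fin n × (Fin S ⊕ Fin T) → ℕ := fun y => Sum.elim (fun s : Fin S => (s : ℕ)) (fun _ : Fin T => 0) y.2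
    have hco_le : ∀ y, colOrder v (E y) ≤ bnd y := by
      rintro ⟨i, s | j⟩
      · exact hco_inl i s
      · exact (hco_inr i j).le
    have step1 : ∏ c, ((N : ℝ) ^ (2 * colOrder v c + 1) * (max 1 ‖v c‖) ^ (2 * (N - 1))) ≤
        ∏ c, ((N : ℝ) ^ (2 * bnd (E.symm c) + 1) * (max 1 ‖v c‖) ^ (2 * (N - 1))) := by
      apply Finset.prod_le_prod (fun c _ => by positivity)
      intro c _
      have hN1 : (1 : ℝ) ≤ N := by
        have hST : 0 < S + T := by
          obtain ⟨i, x⟩ := E.symm c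
          rcases x with s | j
          · exact Nat.add_pos_left s.pos T
          · exact Nat.add_pos_right S j.pos
        have : 1 ≤ N := by rw [hN]; exact Nat.mul_pos hnpos hST
        exact_mod_cast this
      refine mul_le_mul_of_nonneg_right (pow_le_pow_right₀ hN1 ?_) (by positivity)
      have := hco_le (E.symm c)
      rw [E.apply_symm_apply] at this
      omega
    refine step1.trans (le_of_eq ?_)
    rw [← Fintype.prod_equiv E (fun y => (N : ℝ) ^ (2 * bnd y + 1) * (max 1 ‖nd y‖) ^ (2 * (N - 1))) _
      (fun y => by rw [E.symm_apply_apply, hvE])]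
    rw [Fintype.prod_prod_type]
    have hper : ∀ i : Fin n, ∏ x : Fin S ⊕ Fin T, ((N : ℝ) ^ (2 * bnd (i, x) + 1) * (max 1 ‖nd (i, x)‖) ^ (2 * (N - 1)))
        = (N : ℝ) ^ (S ^ 2 + T) * (max 1 ‖α i‖) ^ (2 * (N - 1) * (S + ∑ j, q j)) := by
      intro i
      rw [Fintype.prod_sum_type]
      simp only [bnd, nd, ex, Sum.elim_inl, Sum.elim_inr, pow_one, mul_zero, zero_add, pow_one, norm_pow]
      rw [Finset.prod_mul_distrib, Finset.prod_mul_distrib, Finset.prod_pow_eq_pow_sum, sum_fin_two_mul_add_one,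
        Finset.prod_const, Finset.card_univ, Fintype.card_fin, Finset.prod_const, Finset.card_univ,
        Fintype.card_fin]
      have hmx : ∀ j : Fin T, max 1 (‖α i‖ ^ q j) = (max 1 ‖α i‖) ^ q j := fun j =>
        (max_one_pow (norm_nonneg _) _).symm
      simp_rw [hmx, ← pow_mul]
      rw [Finset.prod_pow_eq_pow_sum, ← Finset.sum_mul]
      ring
    simp_rw [hper]
    rw [Finset.prod_mul_distrib, Finset.prod_const, Finset.card_univ, Fintype.card_fin, ← pow_mul,
      Finset.prod_pow, ← hMeq]
    ring
  -- (5) the lower bound (arithmetic)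
  have hlow : ((∏ j, (q j : ℝ)) ^ n) ^ (2 * S) ≤ ‖(confluentVandermonde v (colOrder v)).det‖ ^ 2 := by
    refine le_of_le_of_eq ?_ (norm_det_confluentVandermonde_sq v).symm
    -- (a) the product in structured form
    have e1 : ∏ c, ∏ c' ∈ univ.filter (fun c' => v c' ≠ v c), ‖v c - v c'‖ =
        ∏ y : Fin n × (Fin S ⊕ Fin T), ∏ y' : Fin n × (Fin S ⊕ Fin T),
          (if y'.1 = y.1 ∧ cls y'.2 = cls y.2 then 1 else ‖nd y - nd y'‖) := by
      rw [← Fintype.prod_equiv E (fun y => ∏ c' ∈ univ.filter (fun c' => v c' ≠ v (E y)), ‖v (E y) - v c'‖) _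
        (fun y => rfl)]
      refine Fintype.prod_congr _ _ fun y => ?_
      rw [Finset.prod_filter, ← Fintype.prod_equiv E
        (fun y' => if v (E y') ≠ v (E y) then ‖v (E y) - v (E y')‖ else 1) _ (fun y' => rfl)]
      refine Fintype.prod_congr _ _ fun y' => ?_
      rw [hvE, hvE]
      by_cases h : y'.1 = y.1 ∧ cls y'.2 = cls y.2
      · rw [if_pos h, if_neg (not_not.2 ((hnode y y').2 h))]
      · rw [if_neg h, if_pos (fun e => h ((hnode y y').1 e))]
    rw [e1]
    -- (b) named blocks
    set D1 : ℝ := ∏ i : Fin n, ∏ i' : Fin n, (if i' = i then 1 else ‖α i - α i'‖) with hD1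
    set Rq : Fin T → ℝ := fun j => ∏ i : Fin n, ∏ i' : Fin n, ‖α i ^ q j - α i'‖ with hRq
    set Rq' : Fin T → ℝ := fun j => ∏ i : Fin n, ∏ i' : Fin n, ‖α i - α i' ^ q j‖ with hRq'
    set Ecr : ℝ := ∏ i : Fin n, ∏ j : Fin T, ∏ i' : Fin n, ∏ j' : Fin T,
      (if i' = i ∧ j' = j then 1 else ‖α i ^ q j - α i' ^ q j'‖) with hEcr
    have c1 : ∏ i : Fin n, ∏ j : Fin T, ∏ i' : Fin n, ‖α i ^ q j - α i'‖ = ∏ j, Rq j := Finset.prod_comm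
    have c2 : ∏ i : Fin n, ∏ i' : Fin n, ∏ j : Fin T, ‖α i - α i' ^ q j‖ = ∏ j, Rq' j :=
      calc _ = ∏ i : Fin n, ∏ j : Fin T, ∏ i' : Fin n, ‖α i - α i' ^ q j‖ :=
            Finset.prod_congr rfl fun i _ => Finset.prod_comm
        _ = ∏ j, Rq' j := Finset.prod_comm
    have e2 : ∏ y : Fin n × (Fin S ⊕ Fin T), ∏ y' : Fin n × (Fin S ⊕ Fin T),
          (if y'.1 = y.1 ∧ cls y'.2 = cls y.2 then 1 else ‖nd y - nd y'‖) =
        D1 ^ (S * S) * (∏ j, Rq j) ^ S * ((∏ j, Rq' j) ^ S * Ecr) := by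
      simp only [Fintype.prod_prod_type, Fintype.prod_sum_type, nd, ex, cls, Sum.elim_inl, Sum.elim_inr, pow_one,
        and_true, and_false, reduceCtorEq, if_false, Option.some.injEq, Finset.prod_const, Finset.card_univ,
        Fintype.card_fin, Finset.prod_mul_distrib, Finset.prod_pow, mul_pow, ← pow_mul]
      rw [c1, c2]
    rw [e2]
    -- (c) the discriminant part
    have hD1ge : 1 ≤ D1 := by
      have hD1eq : D1 = ∏ i : Fin n, ∏ i' ∈ univ.erase i, ‖α i - α i'‖ := by
        rw [hD1]
        exact Finset.prod_congr rfl fun i _ => (prod_erase_eq_prod_ite i (fun i' => ‖α i - α i'‖)).symm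
      rw [hD1eq]
      refine one_le_norm_prod_sub f hmon α (by rw [hα]) ?_
      rw [Finset.prod_ne_zero_iff]
      intro i _
      rw [Finset.prod_ne_zero_iff]
      intro i' hi'
      exact sub_ne_zero.2 fun h => Finset.ne_of_mem_erase hi' (hαinj h).symm
    -- (d) the resultant part
    have hRqge : ∀ j, (q j : ℝ) ^ n ≤ Rq j := by
      intro j
      have hp := hq j
      have hsep : ∀ a ∈ (f.map (Int.castRingHom ℂ)).roots, ∀ b ∈ (f.map (Int.castRingHom ℂ)).roots,
          a ^ q j ≠ b := by
        intro a ha b hb hab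
        have h := root_pow_ne_root_pow hmon hirr hM hnd ha hb hp.pos Nat.one_pos hp.one_lt.ne'
        exact h (by rwa [pow_one])
      have hne := resultant_expand_ne_zero hmon.ne_zero hsep
      have h1 := prime_pow_le_abs_resultant_expand hp hne
      have h2 := resultant_intCast_eq (f := f) (G := expand ℤ (q j) f) (N := f.natDegree * q j)
        (by rw [natDegree_expand])
      have hev : ∀ a : ℂ, ((expand ℤ (q j) f).map (Int.castRingHom ℂ)).eval a = ∏ i' : Fin n, (a ^ q j - α i') := by
        intro a
        rw [map_expand, expand_eval]
        conv_lhs => rw [← hg, Splits.eq_prod_roots_of_monic hsplit hgmon, eval_multiset_prod]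
        rw [Multiset.map_map, ← hR, multiset_prod_map_eq_prod α hα]
        simp
      have h3 : ((f.resultant (expand ℤ (q j) f) f.natDegree (f.natDegree * q j) : ℤ) : ℂ) =
          ∏ i : Fin n, ∏ i' : Fin n, (α i ^ q j - α i') := by
        rw [h2, ← hg, hgmon.leadingCoeff, one_pow, one_mul, ← hR]
        rw [show (R.map ((expand ℤ (q j) f).map (Int.castRingHom ℂ)).eval) =
          R.map (fun a => ∏ i' : Fin n, (a ^ q j - α i')) from Multiset.map_congr rfl fun a _ => hev a]
        exact multiset_prod_map_eq_prod α hα _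
      have h4 : ‖((f.resultant (expand ℤ (q j) f) f.natDegree (f.natDegree * q j) : ℤ) : ℂ)‖ = Rq j := by
        rw [h3, norm_prod]
        exact Finset.prod_congr rfl fun i _ => norm_prod _ _
      rw [← h4, Complex.norm_intCast, hnd']
      have h5 : (((q j : ℤ) ^ f.natDegree : ℤ) : ℝ) ≤
          ((|f.resultant (expand ℤ (q j) f) f.natDegree (f.natDegree * q j)| : ℤ) : ℝ) := by
        exact_mod_cast h1
      rw [Int.cast_abs] at h5
      exact_mod_cast h5
    have hRq'eq : ∀ j, Rq' j = Rq j := by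
      intro j
      simp only [hRq, hRq']
      rw [Finset.prod_comm]
      exact Finset.prod_congr rfl fun i _ => Finset.prod_congr rfl fun i' _ => norm_sub_rev _ _
    -- (e) the cross part
    have hEge : 1 ≤ Ecr := by
      have hEeq : Ecr = ∏ u : Fin n × Fin T, ∏ w ∈ univ.erase u, ‖α u.1 ^ q u.2 - α w.1 ^ q w.2‖ := by
        rw [hEcr, Fintype.prod_prod_type]
        refine Finset.prod_congr rfl fun i _ => Finset.prod_congr rfl fun j _ => ?_
        rw [prod_erase_eq_prod_ite, Fintype.prod_prod_type]
        refine Finset.prod_congr rfl fun i' _ => Finset.prod_congr rfl fun j' _ => ?_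
        simp only [Prod.mk.injEq]
      rw [hEeq]
      refine one_le_norm_prod_pow_sub_pow_pairs f hmon α (by rw [hα]) q ?_
      rw [Finset.prod_ne_zero_iff]
      intro u _
      rw [Finset.prod_ne_zero_iff]
      intro w hw
      rw [sub_ne_zero]
      intro heq
      have h := (hnode (u.1, Sum.inr u.2) (w.1, Sum.inr w.2)).1 heq.symm
      simp only [cls, Sum.elim_inr, Option.some.injEq] at h
      exact (Finset.ne_of_mem_erase hw) (Prod.ext h.1 h.2)
    -- (f) assemble
    have hq0 : 0 ≤ (∏ j, (q j : ℝ)) ^ n := by positivity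
    have hRq0 : ∀ j, 0 ≤ Rq j := fun j => le_trans (by positivity) (hRqge j)
    have hA : ((∏ j, (q j : ℝ)) ^ n) ^ S ≤ (∏ j, Rq j) ^ S := by
      apply pow_le_pow_left₀ hq0
      rw [← Finset.prod_pow]
      exact Finset.prod_le_prod (fun j _ => by positivity) (fun j _ => hRqge j)
    have hA' : ((∏ j, (q j : ℝ)) ^ n) ^ S ≤ (∏ j, Rq' j) ^ S := by
      simp only [hRq'eq]
      exact hA
    have hRqprod0 : 0 ≤ ∏ j, Rq j := Finset.prod_nonneg fun j _ => hRq0 j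
    calc ((∏ j, (q j : ℝ)) ^ n) ^ (2 * S)
        = ((∏ j, (q j : ℝ)) ^ n) ^ S * ((∏ j, (q j : ℝ)) ^ n) ^ S := by rw [two_mul, pow_add]
      _ ≤ (D1 ^ (S * S) * (∏ j, Rq j) ^ S) * ((∏ j, Rq' j) ^ S * Ecr) := by
          apply mul_le_mul
          · calc ((∏ j, (q j : ℝ)) ^ n) ^ S = 1 * ((∏ j, (q j : ℝ)) ^ n) ^ S := (one_mul _).symm
              _ ≤ D1 ^ (S * S) * (∏ j, Rq j) ^ S :=
                mul_le_mul (one_le_pow₀ hD1ge) hA (by positivity) (pow_nonneg (zero_le_one.trans hD1ge) _)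
          · calc ((∏ j, (q j : ℝ)) ^ n) ^ S = ((∏ j, (q j : ℝ)) ^ n) ^ S * 1 := (mul_one _).symm
              _ ≤ (∏ j, Rq' j) ^ S * Ecr :=
                mul_le_mul hA' hEge zero_le_one (pow_nonneg (by simp only [hRq'eq]; exact hRqprod0) _)
          · positivity
          · exact mul_nonneg (pow_nonneg (zero_le_one.trans hD1ge) _) (pow_nonneg hRqprod0 _)
      _ = D1 ^ (S * S) * (∏ j, Rq j) ^ S * ((∏ j, Rq' j) ^ S * Ecr) := by ring
  -- (6) combine
  have h := hlow.trans hup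
  rw [← hnd']
  exact h

end Summit.Ventures.DiscreteObjects.Mahler
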